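import Summits.NavierStokesRegularity.NavierStokesRegularity.Theses.ExtremalTypeIConstant
import Literature.Analysis.FluidPDE.TypeIAncientMild
import Literature.Analysis.FluidPDE.OseenDuhamelPairCalculus
import Literature.Analysis.FluidPDE.MildSolutionProofs
import HarnessLib

/-!
# Route `ExtremalTypeIConstant`, support item `SmallConstantLiouville` (stmt-NavierStokesRegularity-8218)

The GAP of the temporal Type-I constant over the KNSS Oseen-gauge ancient class: there is
`c₀ > 0` such that every Type-I ancient mild field `u` (jointly smooth on `(−∞,0) × ℝ³`,
divergence-free, `u(t) = e^{(t−s)Δ}u(s) − B¹_s(u,u)(t)` for all `s < t < 0`,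
`‖u(t,x)‖ ≤ C/√(−t)`) with constant `C < c₀` vanishes identically (Koch–Nadirashvili–Seregin–Šverák
2009, §4 p. 8: `‖B(u,v)‖ ≤ C√T ‖u‖ ‖v‖`; the small-constant Picard bound in the gauge).

Proof (a bootstrap that avoids the improper time integral of the route text). Restart the Oseen
identity at `s = 4t`. If `‖u(τ,y)‖ ≤ A/√(−τ)` everywhere, then at `(t, x)`:
the caloric term is bounded by `sup ‖u(4t, ·)‖ ≤ A/√(−4t) = A/(2√(−t))` (`norm_heatFlow_le`), and
the Duhamel term by `C₀ (A/√(−t))² · 2√(t − 4t) ≤ 4 C₀ A²/√(−t)` (`norm_oseenDuhamel_le_const`,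
`C₀ = oseenSliceConst`, `√3 ≤ 2`). Hence `A ↦ A (1/2 + 4 C₀ A) ≤ A θ` with
`θ = 1/2 + 4 C₀ C < 1` as soon as `C < c₀ := 1/(8 C₀)`; iterating, `‖u(t,x)‖ ≤ C θⁿ/√(−t) → 0`.

References: KNSS 2009 = arXiv:0709.3599, §4 p. 8 (the bilinear bound), §6 (Type I ancient
solutions); Koch–Tataru 2001, (14).
-/

noncomputable section

namespace Summit.NavierStokesRegularity.NavierStokesRegularity.Theorems

open MeasureTheory Set Function Filter Topology
open Literature.Analysis Literature.Analysis.FluidPDE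
open Summit.NavierStokesRegularity.NavierStokesRegularity.Theses.ExtremalTypeIConstant

-- the summit namespace `…NavierStokesRegularity.NavierStokesRegularity…` is the tree convention (D-0017)
set_option linter.dupNamespace false

variable {E : Type*} [NormedAddCommGroup E] [InnerProductSpace ℝ E] [FiniteDimensional ℝ E]
  [MeasurableSpace E] [BorelSpace E]

/-- **One bootstrap step.** If a Type-I ancient mild field obeys `‖u(τ,y)‖ ≤ A/√(−τ)` on
`τ < 0` with `0 ≤ A`, then restarting the Oseen identity at `s = 4t` gives
`‖u(t,x)‖ ≤ A (1/2 + 4 C₀ A)/√(−t)`, `C₀ = oseenSliceConst E` (KNSS 2009, §4 p. 8: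
`‖e^{σΔ}a‖_∞ ≤ ‖a‖_∞`, `‖B(u,v)‖ ≤ C√T‖u‖‖v‖`). [cite: KochNadirashviliSereginSverak2009, §4 p. 8 (arXiv:0709.3599)] -/
theorem smallConstantLiouville_step {C : ℝ} {u : ℝ → E → E} (h : IsTypeIAncientMild C u)
    {A : ℝ} (hA : 0 ≤ A) (hbound : ∀ τ < 0, ∀ y, ‖u τ y‖ ≤ A / Real.sqrt (-τ))
    {t : ℝ} (ht : t < 0) (x : E) :
    ‖u t x‖ ≤ A * (1 / 2 + 4 * oseenSliceConst E * A) / Real.sqrt (-t) := by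
  set s : ℝ := 4 * t with hs
  have hst : s < t := by rw [hs]; linarith
  have hs0 : s < 0 := hst.trans ht
  have hsq_pos : 0 < Real.sqrt (-t) := Real.sqrt_pos.2 (by linarith)
  have hC₀ : 0 < oseenSliceConst E := oseenSliceConst_pos
  -- the caloric term
  have hheat : ‖heatFlow (u s) (t - s) x‖ ≤ A / (2 * Real.sqrt (-t)) := by
    have hsup : ∀ z, ‖u s z‖ ≤ A / (2 * Real.sqrt (-t)) := by
      intro z
      have hz := hbound s hs0 z
      have hsqs : Real.sqrt (-s) = 2 * Real.sqrt (-t) := by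
        rw [hs, show -(4 * t) = 2 ^ 2 * (-t) by ring, Real.sqrt_mul (by norm_num),
          Real.sqrt_sq (by norm_num : (0 : ℝ) ≤ 2)]
      rwa [hsqs] at hz
    exact norm_heatFlow_le hsup (t - s) x
  -- the Duhamel term
  have hslab : ∀ τ ∈ Ioo s t, ∀ y, ‖u τ y‖ ≤ A / Real.sqrt (-t) := by
    intro τ hτ y
    refine (hbound τ (hτ.2.trans ht) y).trans ?_
    exact div_le_div_of_nonneg_left hA hsq_pos (Real.sqrt_le_sqrt (by linarith [hτ.2]))
  have hduh : ‖oseenDuhamel 1 s u u t x‖ ≤ 4 * oseenSliceConst E * A ^ 2 / Real.sqrt (-t) := by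
    refine (norm_oseenDuhamel_le_const hst.le hslab hslab x).trans ?_
    have hts : Real.sqrt (t - s) ≤ 2 * Real.sqrt (-t) := by
      rw [hs, show t - 4 * t = 3 * (-t) by ring]
      calc Real.sqrt (3 * (-t)) ≤ Real.sqrt (2 ^ 2 * (-t)) :=
            Real.sqrt_le_sqrt (by nlinarith)
        _ = 2 * Real.sqrt (-t) := by
            rw [Real.sqrt_mul (by norm_num), Real.sqrt_sq (by norm_num : (0 : ℝ) ≤ 2)]
    have hsq_sq : Real.sqrt (-t) ^ 2 = -t := Real.sq_sqrt (by linarith)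
    have hprod : A / Real.sqrt (-t) * (A / Real.sqrt (-t)) = A ^ 2 / (-t) := by
      rw [div_mul_div_comm, ← pow_two, ← pow_two, hsq_sq]
    rw [hprod]
    have hnt : 0 < -t := by linarith
    calc oseenSliceConst E * (A ^ 2 / -t) * (2 * Real.sqrt (t - s))
        ≤ oseenSliceConst E * (A ^ 2 / -t) * (2 * (2 * Real.sqrt (-t))) := by
          gcongr
      _ = 4 * oseenSliceConst E * A ^ 2 / Real.sqrt (-t) := by
          rw [show (4 : ℝ) * oseenSliceConst E * A ^ 2 / Real.sqrt (-t)
              = 4 * oseenSliceConst E * A ^ 2 * Real.sqrt (-t) / (Real.sqrt (-t) * Real.sqrt (-t))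
              by rw [mul_div_mul_right _ _ hsq_pos.ne']]
          rw [← pow_two, hsq_sq]
          ring
  -- assemble
  calc ‖u t x‖ = ‖heatFlow (u s) (t - s) x - oseenDuhamel 1 s u u t x‖ := by
        rw [← h.mild_eq hst ht x]
    _ ≤ ‖heatFlow (u s) (t - s) x‖ + ‖oseenDuhamel 1 s u u t x‖ := norm_sub_le _ _
    _ ≤ A / (2 * Real.sqrt (-t)) + 4 * oseenSliceConst E * A ^ 2 / Real.sqrt (-t) :=
        add_le_add hheat hduh
    _ = A * (1 / 2 + 4 * oseenSliceConst E * A) / Real.sqrt (-t) := by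
        field_simp

/-- **The bootstrap, iterated.** With `θ = 1/2 + 4 C₀ C`, a Type-I ancient mild field with
constant `C < 1/(8 C₀)` obeys `‖u(t,x)‖ ≤ C θⁿ/√(−t)` for every `n` (induction on `n` with
`smallConstantLiouville_step`; `0 ≤ θ ≤ 1` keeps `C θⁿ ≤ C`). [cite: KochNadirashviliSereginSverak2009, §4 p. 8 (arXiv:0709.3599)] -/
theorem smallConstantLiouville_iterate {C : ℝ} {u : ℝ → E → E} (h : IsTypeIAncientMild C u)
    (hC : C < 1 / (8 * oseenSliceConst E)) (n : ℕ) :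
    ∀ t < 0, ∀ x, ‖u t x‖ ≤ C * (1 / 2 + 4 * oseenSliceConst E * C) ^ n / Real.sqrt (-t) := by
  have hC₀ : 0 < oseenSliceConst E := oseenSliceConst_pos
  have hCnn : 0 ≤ C := h.nonneg
  set θ : ℝ := 1 / 2 + 4 * oseenSliceConst E * C with hθ
  have hθ0 : 0 ≤ θ := by rw [hθ]; positivity
  have hθ1 : θ ≤ 1 := by
    have h8 : 8 * oseenSliceConst E * C < 1 := by
      have := (lt_div_iff₀ (by positivity : (0 : ℝ) < 8 * oseenSliceConst E)).1 hC
      linarith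
    rw [hθ]; linarith
  induction n with
  | zero =>
      intro t ht x
      simpa using h.norm_le ht x
  | succ n ih =>
      intro t ht x
      have hA : 0 ≤ C * θ ^ n := mul_nonneg hCnn (pow_nonneg hθ0 n)
      have hAC : C * θ ^ n ≤ C := mul_le_of_le_one_right hCnn (pow_le_one₀ hθ0 hθ1)
      have hstep := smallConstantLiouville_step h hA ih ht x
      have hsq_pos : 0 < Real.sqrt (-t) := Real.sqrt_pos.2 (by linarith)
      refine hstep.trans (div_le_div_of_nonneg_right ?_ hsq_pos.le)
      calc C * θ ^ n * (1 / 2 + 4 * oseenSliceConst E * (C * θ ^ n))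
          ≤ C * θ ^ n * θ := by
            refine mul_le_mul_of_nonneg_left ?_ hA
            rw [hθ]
            gcongr
        _ = C * θ ^ (n + 1) := by ring

/-- **Small-constant Liouville in the class vocabulary.** A Type-I ancient mild field in the KNSS
Oseen gauge (`IsTypeIAncientMild C u`) with `C < 1/(8 C₀)`, `C₀ = oseenSliceConst E`, vanishes on
`t < 0`: `‖u(t,x)‖ ≤ C θⁿ/√(−t) → 0` (`θ < 1`). [cite: KochNadirashviliSereginSverak2009, §4 p. 8 and §6 (arXiv:0709.3599)] -/
theorem smallConstantLiouville_eq_zero {C : ℝ} {u : ℝ → E → E} (h : IsTypeIAncientMild C u)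
    (hC : C < 1 / (8 * oseenSliceConst E)) {t : ℝ} (ht : t < 0) (x : E) : u t x = 0 := by
  have hC₀ : 0 < oseenSliceConst E := oseenSliceConst_pos
  have hCnn : 0 ≤ C := h.nonneg
  set θ : ℝ := 1 / 2 + 4 * oseenSliceConst E * C with hθ
  have hθ0 : 0 ≤ θ := by rw [hθ]; positivity
  have hθ1 : θ < 1 := by
    have h8 : 8 * oseenSliceConst E * C < 1 := by
      have := (lt_div_iff₀ (by positivity : (0 : ℝ) < 8 * oseenSliceConst E)).1 hC
      linarith
    rw [hθ]; linarith
  have hlim : Tendsto (fun n : ℕ => C * θ ^ n / Real.sqrt (-t)) atTop (𝓝 0) := by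
    have := ((tendsto_pow_atTop_nhds_zero_of_lt_one hθ0 hθ1).const_mul C).div_const
      (Real.sqrt (-t))
    simpa using this
  have hle : ‖u t x‖ ≤ 0 :=
    ge_of_tendsto' hlim fun n => smallConstantLiouville_iterate h hC n t ht x
  exact norm_le_zero_iff.1 hle

/-- **`SmallConstantLiouville` (stmt-NavierStokesRegularity-8218).** There is `c₀ > 0` —
here `c₀ = 1/(8 C₀)` with `C₀ = oseenSliceConst ℝ³` the constant of the slice bound
`‖∫ K(σ, x−y)[a(y), b(y)] dy‖ ≤ C₀ σ^{-1/2} ‖a‖_∞ ‖b‖_∞` — such that every smooth divergence-free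
KNSS-mild ancient field on `(−∞,0) × ℝ³` with `‖u(t,x)‖ ≤ C/√(−t)`, `C < c₀`, is identically zero
(the gap below the Type-I constants of nontrivial ancient solutions; KNSS 2009 §4 p. 8, §6). [cite: KochNadirashviliSereginSverak2009, §4 p. 8 and §6 (arXiv:0709.3599)] -/
theorem extremalTypeIConstant_smallConstantLiouville_proof : SmallConstantLiouville := by
  unfold SmallConstantLiouville
  refine ⟨1 / (8 * oseenSliceConst (EuclideanSpace ℝ (Fin 3))),
    by have := oseenSliceConst_pos (E := EuclideanSpace ℝ (Fin 3)); positivity, ?_⟩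
  intro C u hu hC t ht x
  exact smallConstantLiouville_eq_zero (isTypeIAncientMild_iff.2 hu) hC ht x

end Summit.NavierStokesRegularity.NavierStokesRegularity.Theorems
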